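import Literature.NumberTheory.Automorphic.UnitaryGroupTruncatedTracePolynomialOfRows
import Literature.NumberTheory.Automorphic.UnitaryGroupTruncatedKernelClassMeasurable
import Mathlib.Algebra.Polynomial.Degree.SmallDegree
import HarnessLib

/-!
# `J^T_𝔬(f)` is affine in `log T` on `U(3)`, class by class: the per-class polynomial from the rows
# (per-class parts identity + `δ_B`-homogeneity of `K_{B,𝔬}` + per-class integrability + a torus Siegel set)
(Arthur, *The trace formula in invariant form*, Ann. of Math. 114 (1981), Prop. 2.3 «`J^T_𝔬` is a polynomial in `T`»;
Rogawski, *Automorphic Representations of Unitary Groups in Three Variables* (1990), §2.3 p. 14; Shokranian (1992),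
Thm. (5.7): degree `dim(A_B/A_G) = 1`)

Topic `NumberTheory/Automorphic`; namespace `Literature.NumberTheory.Automorphic.UnitaryGroup`. THEOREMS ONLY over
accepted tree modules: no definition, no named fact, no instance, no notation, no `sorry`. Piece (3c-e) of the T1-qs
LAW 3 road, item (3c) «per-class polynomial» (cell `pub/hodgecm-mathlib`, crux H413) — the class-by-class copy of ★
`truncatedTracePolynomial_of_integrable_of_torusSiegel` (`UnitaryGroupTruncatedTracePolynomialOfRows`) in the letters
of ★ `UnitaryGroupArthurKernelClassExpansion` (`K_{B,𝔬} = kernelBorelClass ν 𝓕 cl i f`, `k^T_𝔬 = truncatedKernelClass`,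
`J^T_𝔬 = truncatedTraceClass μ ν 𝓕 T cl i f`), HYPOTHESES-FIRST in the two class inputs of the road:

* `hhom` — the `δ_B`-HOMOGENEITY `K_{B,𝔬}(b x, b y) = δ_B(b) • K_{B,𝔬}(x, y)` (row (C8), per-class of ★
  `kernelBorel_borel_mul_mul`);
* `hparts` — the PER-CLASS PARTS IDENTITY `J^{T'}_𝔬 − J^{T}_𝔬 = Σ_j ε_j (C ∫⁻ β · ofReal(±re∕±im window_𝔬)).toReal`
  (row (L3-uℂ𝔬), per-class of ★ `exists_truncatedTrace_sub_eq_parts`, over ★ (3c-a)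
  `truncatedKernelClass_sub_truncatedKernelClass` and ★ L2-u);

the window parts themselves integrate by the θ-GENERIC ★ `exists_lintegral_weight_windowPart_eq` (L2-e1) — no class
copy needed there. Conclusion: for every `i`, `J^T_𝔬(f) = p_𝔬(log T)` above the per-class integrability threshold,
`deg p_𝔬 ≤ 1`.

* §1 `ofReal_apply_kernelBorelClass_borel_mul` — the four parts of `K_{B,𝔬}(y,y)` are `δ_B`-homogeneous (from `hhom`).
* §2 **`truncatedTraceClassPolynomial_of_parts`**.

## References

* J. Arthur, *The trace formula in invariant form*, Ann. of Math. 114 (1981), Prop. 2.3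
  [Arthur1981TraceFormulaInvariantForm].
* J. D. Rogawski, *Automorphic Representations of Unitary Groups in Three Variables*, Annals of Mathematics
  Studies 123 (1990), §2.3 (p. 14) [Rogawski1990].
* S. Shokranian, *The Selberg–Arthur Trace Formula*, LNM 1503 (1992), Thm. (5.7), Rem. (5.8) [Shokranian1992].
-/

set_option autoImplicit false

noncomputable section

open MeasureTheory Measure NumberField IsDedekindDomain Set Polynomial Literature.MeasureTheory.Group
open scoped NNReal ENNReal Pointwise

namespace Literature.NumberTheory.Automorphic

namespace UnitaryGroup

variable {F E : Type} [Field F] [NumberField F] [Field E] [NumberField E] [Algebra F E]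
  {c : E ≃ₐ[F] E} {ι : Type*}

/-! ## §1 The four parts of `K_{B,𝔬}(y, y)` are `δ_B`-homogeneous -/

section Parts

variable [MeasurableSpace (adelicUnipotent F E c 3)]

/-- **The four parts of the diagonal class Borel kernel are `δ_B`-homogeneous**, granted the homogeneity
`K_{B,𝔬}(b x, b y) = δ_B(b) • K_{B,𝔬}(x, y)` (row (C8)): for any real-linear `φ` (the parts `±re, ±im`),
`ofReal (φ (K_{B,𝔬}(b k, b k))) = δ_B(b) · ofReal (φ (K_{B,𝔬}(k, k)))`. [cite: Rogawski1990, §2.2 (p. 13)] -/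
theorem ofReal_apply_kernelBorelClass_borel_mul {ν : Measure (adelicUnipotent F E c 3)}
    {𝓕 : Set (adelicUnipotent F E c 3)} {cl : (quasiSplit F E c 3).arithmeticSubgroup → ι} {i : ι}
    {f : (quasiSplit F E c 3).Adelic → ℂ}
    (hhom : ∀ (b : borelAdelic F E c 3) (x y : (quasiSplit F E c 3).Adelic),
      kernelBorelClass ν 𝓕 cl i f ((b : (quasiSplit F E c 3).Adelic) * x) ((b : (quasiSplit F E c 3).Adelic) * y) =
        (torusRootModulus E 3 (diagUnit b.2) : ℝ) • kernelBorelClass ν 𝓕 cl i f x y)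
    {φ : ℂ → ℝ} (hφ : ∀ (r : ℝ) (z : ℂ), φ ((r : ℂ) * z) = r * φ z)
    (b : borelAdelic F E c 3) (k : (quasiSplit F E c 3).Adelic) :
    ENNReal.ofReal (φ (kernelBorelClass ν 𝓕 cl i f ((b : (quasiSplit F E c 3).Adelic) * k)
      ((b : (quasiSplit F E c 3).Adelic) * k))) =
      ((torusRootModulus E 3 (diagUnit b.2) : ℝ≥0) : ℝ≥0∞) * ENNReal.ofReal (φ (kernelBorelClass ν 𝓕 cl i f k k)) := by
  rw [hhom b k k, Complex.real_smul, hφ, ENNReal.ofReal_mul (NNReal.coe_nonneg _), ENNReal.ofReal_coe_nnreal]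

end Parts

/-! ## §2 The per-class polynomial -/

/-- **`J^T_𝔬(f)` IS AFFINE IN `log T`, FROM THE ROWS.** Hypotheses: `c² = 1 ≠ c`; unimodularity of `U(J₃)(𝔸_F)`
and the Iwasawa decomposition (`hunimod`, `hBK` — ★ for CM pairs); a class map `cl` (any `ι`) and an index `i`;
the `δ_B`-homogeneity `hhom` of `K_{B,𝔬}` for every Haar `ν` and fundamental domain `𝓕` (row (C8)); the per-class
parts identity `hparts` (row (L3-uℂ𝔬)) with ONE constant `C` for all windows; the per-class integrability `hint`
(LAW 3 (a), ★-to-be `truncatedKernelClassIntegrable_cm`); and a CLOSED coordinate torus Siegel set meeting every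
`T(F)`-orbit (`hST`, ★ H9a). Conclusion: for every Haar measure `ν` of `N(𝔸_F)`, fundamental domain `𝓕`, automorphic
measure `μ` and quasi-split test function `f` there is `p ∈ ℂ[X]` of degree `≤ 1` with `J^T_𝔬(f) = p(log T)` for all
large `T` — the class window parts integrate by the θ-generic ★ `exists_lintegral_weight_windowPart_eq`.
[cite: Arthur1981TraceFormulaInvariantForm, Prop. 2.3] [cite: Rogawski1990, §2.3 (p. 14)]
[cite: Shokranian1992, Thm. (5.7) and Rem. (5.8)] -/
theorem truncatedTraceClassPolynomial_of_parts (hc : c * c = 1) (hc1 : c ≠ 1)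
    (hunimod : ∀ [MeasurableSpace (quasiSplit F E c 3).Adelic] [BorelSpace (quasiSplit F E c 3).Adelic]
      (νG : Measure (quasiSplit F E c 3).Adelic), νG.IsHaarMeasure → νG.IsMulRightInvariant)
    (hBK : ∀ g : (quasiSplit F E c 3).Adelic, ∃ b ∈ borelAdelic F E c 3, ∃ k : (quasiSplit F E c 3).Adelic,
      adelicVal F E c 3 ((StdForm.antidiagonal 3).over E) k ∈ standardMaximalCompactGL 3 E ∧ g = b * k)
    (cl : (quasiSplit F E c 3).arithmeticSubgroup → ι) (i : ι)
    (hhom : ∀ [MeasurableSpace (adelicUnipotent F E c 3)] [BorelSpace (adelicUnipotent F E c 3)]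
      (ν : Measure (adelicUnipotent F E c 3)) [ν.IsHaarMeasure] (𝓕 : Set (adelicUnipotent F E c 3)),
      IsFundamentalDomain (rationalUnipotent F E c 3) 𝓕 ν →
      ∀ (f : (quasiSplit F E c 3).Adelic → ℂ), Continuous f → HasCompactSupport f →
      ∀ (b : borelAdelic F E c 3) (x y : (quasiSplit F E c 3).Adelic),
        kernelBorelClass ν 𝓕 cl i f ((b : (quasiSplit F E c 3).Adelic) * x) ((b : (quasiSplit F E c 3).Adelic) * y) =
          (torusRootModulus E 3 (diagUnit b.2) : ℝ) • kernelBorelClass ν 𝓕 cl i f x y)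
    (hparts : ∀ [MeasurableSpace (adelicUnipotent F E c 3)] [BorelSpace (adelicUnipotent F E c 3)]
      [MeasurableSpace (quasiSplit F E c 3).Adelic] [BorelSpace (quasiSplit F E c 3).Adelic]
      (ν : Measure (adelicUnipotent F E c 3)) [ν.IsHaarMeasure] (𝓕 : Set (adelicUnipotent F E c 3)),
      IsFundamentalDomain (rationalUnipotent F E c 3) 𝓕 ν →
      ∀ (μ : Measure (quasiSplit F E c 3).automorphicQuotient) [(quasiSplit F E c 3).IsAutomorphicMeasure μ]
        (νG : Measure (quasiSplit F E c 3).Adelic) [νG.IsHaarMeasure] [νG.IsInvInvariant]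
        (f : (quasiSplit F E c 3).Adelic → ℂ), Continuous f → HasCompactSupport f →
      ∀ (β : (quasiSplit F E c 3).Adelic → ℝ≥0∞),
        IsCoveringWeight ((arithmeticBorel F E c 3).map (quasiSplit F E c 3).arithmeticSubgroup.subtype) β →
      ∃ C : ℝ≥0∞, C ≠ ⊤ ∧ ∀ T T' : ℝ≥0, 1 ≤ T → T ≤ T' →
        Integrable ((quasiSplit F E c 3).quotFun (truncatedKernelClass ν 𝓕 T cl i f)) μ →
        Integrable ((quasiSplit F E c 3).quotFun (truncatedKernelClass ν 𝓕 T' cl i f)) μ →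
        truncatedTraceClass μ ν 𝓕 T' cl i f - truncatedTraceClass μ ν 𝓕 T cl i f =
          (((C * ∫⁻ y, β y * ENNReal.ofReal
              ({y : (quasiSplit F E c 3).Adelic | T < borelHeight y ∧ borelHeight y ≤ T'}.indicator
                (fun y => kernelBorelClass ν 𝓕 cl i f y y) y).re ∂νG).toReal -
            (C * ∫⁻ y, β y * ENNReal.ofReal
              (-({y : (quasiSplit F E c 3).Adelic | T < borelHeight y ∧ borelHeight y ≤ T'}.indicator
                (fun y => kernelBorelClass ν 𝓕 cl i f y y) y).re) ∂νG).toReal : ℝ) : ℂ) +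
          (((C * ∫⁻ y, β y * ENNReal.ofReal
              ({y : (quasiSplit F E c 3).Adelic | T < borelHeight y ∧ borelHeight y ≤ T'}.indicator
                (fun y => kernelBorelClass ν 𝓕 cl i f y y) y).im ∂νG).toReal -
            (C * ∫⁻ y, β y * ENNReal.ofReal
              (-({y : (quasiSplit F E c 3).Adelic | T < borelHeight y ∧ borelHeight y ≤ T'}.indicator
                (fun y => kernelBorelClass ν 𝓕 cl i f y y) y).im) ∂νG).toReal : ℝ) : ℂ) * Complex.I)
    (hint : ∀ [MeasurableSpace (adelicUnipotent F E c 3)] [BorelSpace (adelicUnipotent F E c 3)]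
      (ν : Measure (adelicUnipotent F E c 3)) [ν.IsHaarMeasure] (𝓕 : Set (adelicUnipotent F E c 3)),
      IsFundamentalDomain (rationalUnipotent F E c 3) 𝓕 ν →
      ∀ (μ : Measure (quasiSplit F E c 3).automorphicQuotient) [(quasiSplit F E c 3).IsAutomorphicMeasure μ]
        (f : (quasiSplit F E c 3).Adelic → ℂ), IsQuasiSplitTest F E c 3 f →
      ∃ T₀ : ℝ≥0, ∀ T : ℝ≥0, T₀ < T →
        Integrable ((quasiSplit F E c 3).quotFun (truncatedKernelClass ν 𝓕 T cl i f)) μ)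
    (hST : ∃ (C₀ C₁ : Set (AdeleRing (𝓞 E) E)ˣ) (S : Set (torusInBorel F E c 3)),
      IsCompact C₀ ∧ IsCompact C₁ ∧ IsClosed S ∧
      (∀ t ∈ S, (∃ w ∈ C₀, ∃ s : ℝ, diagUnit (t : borelAdelic F E c 3).2 0 = w * posRealIdele E (expUnitNNReal s)) ∧
        diagUnit (t : borelAdelic F E c 3).2 1 ∈ C₁) ∧
      (∀ t : torusInBorel F E c 3,
        ∃ τ : (rationalBorel F E c 3).subgroupOf (torusInBorel F E c 3), τ • t ∈ S)) :
    ∀ [MeasurableSpace (adelicUnipotent F E c 3)] [BorelSpace (adelicUnipotent F E c 3)]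
      (ν : Measure (adelicUnipotent F E c 3)) [ν.IsHaarMeasure] (𝓕 : Set (adelicUnipotent F E c 3)),
      IsFundamentalDomain (rationalUnipotent F E c 3) 𝓕 ν →
      ∀ (μ : Measure (quasiSplit F E c 3).automorphicQuotient) [(quasiSplit F E c 3).IsAutomorphicMeasure μ]
        (f : (quasiSplit F E c 3).Adelic → ℂ), IsQuasiSplitTest F E c 3 f →
      ∃ p : ℂ[X], p.natDegree ≤ 1 ∧ ∃ T₀ : ℝ≥0, ∀ T : ℝ≥0, T₀ < T →
        truncatedTraceClass μ ν 𝓕 T cl i f = p.eval ((Real.log (T : ℝ) : ℝ) : ℂ) := by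
  intro mN bN ν hν 𝓕 h𝓕 μ hμ f hf
  classical
  -- structure on `G(𝔸)`: Borel σ-algebra, Haar measure (right and inversion invariant by unimodularity)
  haveI := secondCountableTopology_adeleRing E
  haveI := locallyCompactSpace_adeleRing' E
  haveI := t2Space_adeleRing_of_numberField E
  haveI : T2Space (quasiSplit F E c 3).Adelic :=
    inferInstanceAs (T2Space (adelic F E c 3 ((StdForm.antidiagonal 3).over E)))
  haveI : LocallyCompactSpace (quasiSplit F E c 3).Adelic :=
    inferInstanceAs (LocallyCompactSpace (adelic F E c 3 ((StdForm.antidiagonal 3).over E)))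
  haveI : SecondCountableTopology (quasiSplit F E c 3).Adelic :=
    inferInstanceAs (SecondCountableTopology (adelic F E c 3 ((StdForm.antidiagonal 3).over E)))
  letI : MeasurableSpace (quasiSplit F E c 3).Adelic := borel _
  haveI : BorelSpace (quasiSplit F E c 3).Adelic := ⟨rfl⟩
  obtain ⟨K₀⟩ := (inferInstance : Nonempty (TopologicalSpace.PositiveCompacts (quasiSplit F E c 3).Adelic))
  set νG : Measure (quasiSplit F E c 3).Adelic := Measure.haarMeasure K₀ with hνG
  haveI : νG.IsMulRightInvariant := hunimod νG inferInstance
  haveI : νG.IsInvInvariant := isInvInvariant_of_isMulRightInvariant νG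
  -- Haar measures on `B(𝔸)`, `K_U`, `T(𝔸)`, `N(𝔸)`
  haveI : LocallyCompactSpace (borelAdelic F E c 3) := locallyCompactSpace_borelAdelic
  haveI : T2Space (borelAdelic F E c 3) := t2Space_borelAdelic
  haveI : CompactSpace ((standardMaximalCompactGL 3 E).comap
      (adelicVal F E c 3 ((StdForm.antidiagonal 3).over E)) : Subgroup (quasiSplit F E c 3).Adelic) :=
    isCompact_iff_compactSpace.1 isCompact_comap_adelicVal_standardMaximalCompactGL
  haveI : LocallyCompactSpace (torusInBorel F E c 3) :=
    (isTopSemidirect_borelAdelic (F := F) (E := E) (c := c) (N := 3)).isClosed_left.locallyCompactSpace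
  haveI : LocallyCompactSpace (unipotentInBorel F E c 3) :=
    (isTopSemidirect_borelAdelic (F := F) (E := E) (c := c) (N := 3)).isClosed_right.locallyCompactSpace
  set μB : Measure (borelAdelic F E c 3) := Measure.haar with hμB
  set μK : Measure ((standardMaximalCompactGL 3 E).comap
      (adelicVal F E c 3 ((StdForm.antidiagonal 3).over E)) : Subgroup (quasiSplit F E c 3).Adelic) :=
    Measure.haar with hμK
  set μT : Measure (torusInBorel F E c 3) := Measure.haar with hμT
  set μN : Measure (unipotentInBorel F E c 3) := Measure.haar with hμN
  -- `N(𝔸_F)` closed: second countable, locally compact, `ν` s-finite (for the measurability of `K_B`)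
  have hNcl : IsClosed ((adelicUnipotent F E c 3 : Set (quasiSplit F E c 3).Adelic)) := by
    change IsClosed (⇑(adelicVal F E c 3 ((StdForm.antidiagonal 3).over E)) ⁻¹'
      ((upperUnitriangular (Fin 3) (AdeleRing (𝓞 E) E) : Subgroup (GL (Fin 3) (AdeleRing (𝓞 E) E))) :
        Set (GL (Fin 3) (AdeleRing (𝓞 E) E))))
    exact (isClosed_upperUnitriangular (R := AdeleRing (𝓞 E) E)).preimage continuous_subtype_val
  haveI : SecondCountableTopology (adelicUnipotent F E c 3) := TopologicalSpace.Subtype.secondCountableTopology _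
  haveI : LocallyCompactSpace (adelicUnipotent F E c 3) := hNcl.locallyCompactSpace
  haveI : SFinite ν := inferInstance
  -- the data
  have hfc : Continuous f := hf.continuous'
  have hfs : HasCompactSupport f := hf.hasCompactSupport'
  obtain ⟨T₀, hT₀⟩ := hint ν 𝓕 h𝓕 μ f hf
  obtain ⟨C₀, C₁, S, hC₀, hC₁, hSc, hS, hcov⟩ := hST
  obtain ⟨β, hβ⟩ := exists_isCoveringWeight_arithmeticBorel_map (F := F) (E := E) (c := c) (N := 3)
  obtain ⟨Cu, -, hparts'⟩ := hparts ν 𝓕 h𝓕 μ νG f hfc hfs β hβ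
  obtain ⟨D, hD⟩ := exists_lintegral_weight_windowPart_eq hc hc1 νG μB μK μT μN hBK hC₀ hC₁ hSc.measurableSet hS hcov hβ
  -- the four homogeneous parts and their `K_U`-masses
  have hKm : Measurable fun y : (quasiSplit F E c 3).Adelic => kernelBorelClass ν 𝓕 cl i f y y :=
    measurable_kernelBorelClass_diag hfc ν 𝓕 cl i
  have hlin_re : ∀ (r : ℝ) (z : ℂ), (fun z : ℂ => z.re) ((r : ℂ) * z) = r * (fun z : ℂ => z.re) z := fun r z => by
    simp
  have hlin_nre : ∀ (r : ℝ) (z : ℂ), (fun z : ℂ => -z.re) ((r : ℂ) * z) = r * (fun z : ℂ => -z.re) z := fun r z => by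
    simp
  have hlin_im : ∀ (r : ℝ) (z : ℂ), (fun z : ℂ => z.im) ((r : ℂ) * z) = r * (fun z : ℂ => z.im) z := fun r z => by
    simp
  have hlin_nim : ∀ (r : ℝ) (z : ℂ), (fun z : ℂ => -z.im) ((r : ℂ) * z) = r * (fun z : ℂ => -z.im) z := fun r z => by
    simp
  -- the common identity for one part `φ ∈ {re, −re, im, −im}`
  have hpart : ∀ (φ : ℂ → ℝ), φ 0 = 0 → Measurable φ → (∀ (r : ℝ) (z : ℂ), φ ((r : ℂ) * z) = r * φ z) →
      ∀ T T' : ℝ≥0, 0 < T → T ≤ T' →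
        ∫⁻ y, β y * ENNReal.ofReal (φ ({y : (quasiSplit F E c 3).Adelic | T < borelHeight y ∧ borelHeight y ≤ T'}.indicator
          (fun y => kernelBorelClass ν 𝓕 cl i f y y) y)) ∂νG =
        D * (∫⁻ k, ENNReal.ofReal (φ (kernelBorelClass ν 𝓕 cl i f (k : (quasiSplit F E c 3).Adelic) (k : (quasiSplit F E c 3).Adelic))) ∂μK) *
          ENNReal.ofReal (Real.log (T' : ℝ) - Real.log (T : ℝ)) := by
    intro φ hφ0 hφm hφl T T' hT hTT'
    have hθm : Measurable fun y : (quasiSplit F E c 3).Adelic => ENNReal.ofReal (φ (kernelBorelClass ν 𝓕 cl i f y y)) :=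
      ENNReal.measurable_ofReal.comp (hφm.comp hKm)
    have h := hD (fun y => ENNReal.ofReal (φ (kernelBorelClass ν 𝓕 cl i f y y))) hθm
      (fun b k _ => ofReal_apply_kernelBorelClass_borel_mul (hhom ν 𝓕 h𝓕 f hfc hfs) hφl b k) T T' hT hTT'
    rw [← h]
    refine lintegral_congr fun y => ?_
    rw [ofReal_apply_indicator_eq_indicator hφ0]
  -- `J^{T'} − J^{T} = D_f (log T' − log T)` for `T₁ < T ≤ T'`, `T₁ = max T₀ 1`
  set a₁ : ℝ := (Cu * (D * ∫⁻ k, ENNReal.ofReal ((kernelBorelClass ν 𝓕 cl i f (k : (quasiSplit F E c 3).Adelic)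
    (k : (quasiSplit F E c 3).Adelic)).re) ∂μK)).toReal with ha₁
  set a₂ : ℝ := (Cu * (D * ∫⁻ k, ENNReal.ofReal (-(kernelBorelClass ν 𝓕 cl i f (k : (quasiSplit F E c 3).Adelic)
    (k : (quasiSplit F E c 3).Adelic)).re) ∂μK)).toReal with ha₂
  set a₃ : ℝ := (Cu * (D * ∫⁻ k, ENNReal.ofReal ((kernelBorelClass ν 𝓕 cl i f (k : (quasiSplit F E c 3).Adelic)
    (k : (quasiSplit F E c 3).Adelic)).im) ∂μK)).toReal with ha₃
  set a₄ : ℝ := (Cu * (D * ∫⁻ k, ENNReal.ofReal (-(kernelBorelClass ν 𝓕 cl i f (k : (quasiSplit F E c 3).Adelic)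
    (k : (quasiSplit F E c 3).Adelic)).im) ∂μK)).toReal with ha₄
  set Df : ℂ := ((a₁ - a₂ : ℝ) : ℂ) + ((a₃ - a₄ : ℝ) : ℂ) * Complex.I with hDf
  have hdiff : ∀ T T' : ℝ≥0, max T₀ 1 < T → T ≤ T' →
      truncatedTraceClass μ ν 𝓕 T' cl i f - truncatedTraceClass μ ν 𝓕 T cl i f =
        Df * (((Real.log (T' : ℝ) - Real.log (T : ℝ) : ℝ)) : ℂ) := by
    intro T T' hT hTT'
    have hT1 : 1 ≤ T := le_of_lt (lt_of_le_of_lt (le_max_right _ _) hT)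
    have hT0 : 0 < T := lt_of_lt_of_le one_pos hT1
    have hTT₀ : T₀ < T := lt_of_le_of_lt (le_max_left _ _) hT
    have hlog : 0 ≤ Real.log (T' : ℝ) - Real.log (T : ℝ) :=
      sub_nonneg.2 (Real.log_le_log (NNReal.coe_pos.2 hT0) (NNReal.coe_le_coe.2 hTT'))
    have hid := hparts' T T' hT1 hTT' (hT₀ T hTT₀) (hT₀ T' (lt_of_lt_of_le hTT₀ hTT'))
    rw [hid, hpart (fun z => z.re) rfl Complex.measurable_re hlin_re T T' hT0 hTT',
      hpart (fun z => -z.re) (by simp) Complex.measurable_re.neg hlin_nre T T' hT0 hTT',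
      hpart (fun z => z.im) rfl Complex.measurable_im hlin_im T T' hT0 hTT',
      hpart (fun z => -z.im) (by simp) Complex.measurable_im.neg hlin_nim T T' hT0 hTT']
    simp only [← mul_assoc, ENNReal.toReal_mul, ENNReal.toReal_ofReal hlog]
    rw [hDf, ha₁, ha₂, ha₃, ha₄]
    simp only [ENNReal.toReal_mul]
    push_cast
    ring
  -- the polynomial
  set T₂ : ℝ≥0 := max T₀ 1 + 1 with hT₂
  have hT₂gt : max T₀ 1 < T₂ := by rw [hT₂]; exact lt_add_one _
  refine ⟨Polynomial.C Df * Polynomial.X + Polynomial.C (truncatedTraceClass μ ν 𝓕 T₂ cl i f - Df * ((Real.log (T₂ : ℝ) : ℝ) : ℂ)),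
    Polynomial.natDegree_linear_le, max T₀ 1, fun T hT => ?_⟩
  rw [Polynomial.eval_add, Polynomial.eval_mul, Polynomial.eval_C, Polynomial.eval_X, Polynomial.eval_C]
  rcases le_total T T₂ with hle | hle
  · have h := hdiff T T₂ hT hle
    have : truncatedTraceClass μ ν 𝓕 T cl i f = truncatedTraceClass μ ν 𝓕 T₂ cl i f - Df * (((Real.log (T₂ : ℝ) - Real.log (T : ℝ) : ℝ)) : ℂ) := by
      rw [← h]; ring
    rw [this]
    push_cast
    ring
  · have h := hdiff T₂ T hT₂gt hle
    have : truncatedTraceClass μ ν 𝓕 T cl i f = truncatedTraceClass μ ν 𝓕 T₂ cl i f + Df * (((Real.log (T : ℝ) - Real.log (T₂ : ℝ) : ℝ)) : ℂ) := by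
      rw [← h]; ring
    rw [this]
    push_cast
    ring

end UnitaryGroup

end Literature.NumberTheory.Automorphic
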